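import Literature.NumberTheory.GaloisRepresentations.PstWeilDeligneTwistDeRham
import Literature.NumberTheory.GaloisRepresentations.PstWeilDeligneTensorCompatible
import HarnessLib

/-!
# The Kronecker product of de Rham representations is de Rham, for every `p`-adic Hodge datum
# — clause (F15a) `PstWeilDeligneData.TensorDeRham` is a THEOREM

Topic `NumberTheory/GaloisRepresentations`; theorems only (no definition, no named fact, no instance).
Continues the accepted `PstWeilDeligneTwistDeRham` (Fontaine, Astérisque 223, Exp. III: the comparison
isomorphism Thm. 1.5.2 and the `⊗`-stability of `B`-admissibility Prop. 1.5.2, in pairing form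
`PeriodRingData.isAdmissible_of_pairing`, used there for the twist by a CHARACTER, `n' = 1`) to
Kronecker products of arbitrary ranks, using the Kronecker frame of the accepted
`FramedRepTensorKronecker` (`kroneckerFrame : (Fin m → C) ⊗ (Fin n → C) ≃ₗ Fin (m·n) → C`, the frame of
`glKronecker` / `FramedRep.tensor`).

## Main results

* `FramedRep.baseChange_tensor`, `FramedRep.conj_tensor`, `HasQlModel.tensor` — the Kronecker product of
  finite models `rE ⊗ rE'` over `E ⊆ ℚ̄_ℓ` is a model of `ρ ⊗ ρ'`
  (`(P ⊗ Q)((rE ⊗ rE') ⊗_E ℚ̄_ℓ)(P ⊗ Q)⁻¹ = P(rE ⊗_E ℚ̄_ℓ)P⁻¹ ⊗ Q(rE' ⊗_E ℚ̄_ℓ)Q⁻¹`; accepted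
  `map_glKronecker`, `glKronecker_mul`, `glKronecker_inv`).
* `PeriodRingData.isAdmissible_restrictScalars_tensor` — **`⊗`-stability, framed form with coefficients**
  (Prop. 1.5.2): for a period-ring datum `𝔅` over `P` and framed `r₁ : Γ →ₜ* GL_m(E')`,
  `r₂ : Γ →ₜ* GL_n(E')` with `E'/P` finite whose `P`-restrictions are `𝔅`-admissible, the
  `P`-restriction of `r₁ ⊗ r₂ : Γ →ₜ* GL_{mn}(E')` is `𝔅`-admissible — `isAdmissible_of_pairing` for the
  `E'`-bilinear (hence `P`-bilinear) Kronecker pairing `(x, y) ↦ kroneckerFrame (x ⊗ y)`, which is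
  equivariant (`kroneckerFrame_map_toLin'`) and onto.
* `FramedRep.IsDeRhamWith.tensor`, `PstWeilDeligneData.IsDeRhamFramed.tensor` — **if
  `ρ : Γ_F →ₜ* GL_m(ℚ̄_ℓ)` and `ρ' : Γ_F →ₜ* GL_n(ℚ̄_ℓ)` are de Rham (for a `ℚ_ℓ`-structure and period-ring
  datum on `F`, resp. for a `p`-adic Hodge datum `𝔇`), then so is `FramedRep.tensor ρ ρ'`** — models over
  `E₁`, `E₂` moved to the compositum (accepted `HasQlModel.baseChange_inclusion`, model independence
  `isAdmissible_of_hasQlModel`), then the two results above.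
* `PstWeilDeligneData.tensorDeRham` — **clause (F15a) `TensorDeRham` of the candidate clause (F15)
  `TensorCompatible` (accepted `PstWeilDeligneTensorCompatible`) HOLDS FOR EVERY DATUM**; hence
  `PstWeilDeligneData.tensorCompatible_iff_tensorWeilDeligne`: (F15) is equivalent to its Weil–Deligne
  half (F15b) `TensorWeilDeligne`, the part genuinely pinned only by specification (docstring there).

## References
* [FontaineAsterisque223III] J.-M. Fontaine, *Représentations p-adiques semi-stables*, Astérisque 223
  (1994), Exp. III, Thm. 1.5.2 and Prop. 1.5.2.
* [BuzzardGeeLMS2014] K. Buzzard, T. Gee, *The conjectural connections …* (2014), §2.2 (finite models).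
* [BourbakiAlgebraI1989] N. Bourbaki, *Algebra I*, II §10 no. 10 (tensor product of matrices).
-/

noncomputable section

open scoped TensorProduct MatrixGroups Matrix Kronecker
open Field Literature.NumberTheory.Automorphic

namespace Literature.NumberTheory.GaloisRepresentations

/-! ### 1. Kronecker products of framed representations: base change, change of frame, models -/

section Framed

variable {G : Type*} [Group G] [TopologicalSpace G] {m n : ℕ}

/-- **Base change commutes with the Kronecker product**: `(ρ ⊗ ρ') ⊗_f B = (ρ ⊗_f B) ⊗ (ρ' ⊗_f B)`
(entrywise: `f` is a ring homomorphism; accepted `map_glKronecker`).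
[cite: BourbakiAlgebraI1989, II §10 no. 10] -/
theorem FramedRep.baseChange_tensor {A B : Type*} [CommRing A] [TopologicalSpace A] [IsTopologicalRing A]
    [CommRing B] [TopologicalSpace B] [IsTopologicalRing B] (f : A →+* B) (hf : Continuous f)
    (ρ : FramedRep G A m) (ρ' : FramedRep G A n) :
    (ρ.tensor ρ').baseChange f hf = (ρ.baseChange f hf).tensor (ρ'.baseChange f hf) := by
  refine ContinuousMonoidHom.ext fun g => ?_
  rw [FramedRep.baseChange_apply, FramedRep.tensor_apply, FramedRep.tensor_apply,
    FramedRep.baseChange_apply, FramedRep.baseChange_apply, map_glKronecker]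

/-- **Change of frame commutes with the Kronecker product**:
`(P ρ P⁻¹) ⊗ (Q ρ' Q⁻¹) = (P ⊗ Q)(ρ ⊗ ρ')(P ⊗ Q)⁻¹` (accepted `glKronecker_mul`, `glKronecker_inv`).
[cite: BourbakiAlgebraI1989, II §10 no. 10] -/
theorem FramedRep.conj_tensor {A : Type*} [CommRing A] [TopologicalSpace A] [IsTopologicalRing A]
    (P : GL (Fin m) A) (Q : GL (Fin n) A) (ρ : FramedRep G A m) (ρ' : FramedRep G A n) :
    (FramedRep.conj P ρ).tensor (FramedRep.conj Q ρ') = FramedRep.conj (glKronecker P Q) (ρ.tensor ρ') := by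
  refine ContinuousMonoidHom.ext fun g => ?_
  rw [FramedRep.tensor_apply, FramedRep.conj_apply, FramedRep.conj_apply, FramedRep.conj_apply,
    FramedRep.tensor_apply, glKronecker_mul, glKronecker_mul, glKronecker_inv]

/-- **The Kronecker product of models is a model of the Kronecker product**: if
`ρ = P (rE ⊗_E ℚ̄_ℓ) P⁻¹` and `ρ' = Q (rE' ⊗_E ℚ̄_ℓ) Q⁻¹` (accepted `HasQlModel`) then
`ρ ⊗ ρ' = (P ⊗ Q) ((rE ⊗ rE') ⊗_E ℚ̄_ℓ) (P ⊗ Q)⁻¹`.  Deliberate dot-notation extension of the accepted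
`Literature.NumberTheory.Automorphic.HasQlModel`, declared with its absolute name.
[cite: BuzzardGeeLMS2014, §2.2] -/
theorem _root_.Literature.NumberTheory.Automorphic.HasQlModel.tensor {K : Type} [Field K] {ℓ : ℕ}
    [Fact ℓ.Prime] {ρ : FramedGaloisRep K (PadicAlgCl ℓ) m} {ρ' : FramedGaloisRep K (PadicAlgCl ℓ) n}
    {E : IntermediateField ℚ_[ℓ] (PadicAlgCl ℓ)} {rE : FramedGaloisRep K E m}
    {rE' : FramedGaloisRep K E n} (h : HasQlModel ρ E rE) (h' : HasQlModel ρ' E rE') :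
    HasQlModel (ρ.tensor ρ') E (rE.tensor rE') := by
  obtain ⟨P, rfl⟩ := h
  obtain ⟨Q, rfl⟩ := h'
  exact ⟨glKronecker P Q, by rw [FramedRep.baseChange_tensor, ← FramedRep.conj_tensor]⟩

end Framed

/-! ### 2. `⊗`-stability of admissibility, framed form with coefficients -/

namespace PeriodRingData

universe u v v' w

variable {Γ : Type u} [Group Γ] [TopologicalSpace Γ] {P : Type v} {E : Type v'} [Field P]
  [TopologicalSpace P] [Field E] [Algebra P E] (𝔅 : PeriodRingData.{u, v, v', w} Γ P E)
  {E' : Type*} [Field E'] [Algebra P E'] [TopologicalSpace E'] [IsTopologicalRing E'] {m n : ℕ}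

/-- **`⊗`-stability of `B`-admissibility for framed representations with coefficients in a finite
extension `E'` of `P`** (Fontaine, Exp. III, Prop. 1.5.2).  If the `P`-restrictions (accepted
`FramedRep.restrictScalars`) of `r₁ : Γ →ₜ* GL_m(E')` and `r₂ : Γ →ₜ* GL_n(E')` are `B`-admissible, so is
the `P`-restriction of the Kronecker product `r₁ ⊗ r₂ : Γ →ₜ* GL_{mn}(E')` (accepted `FramedRep.tensor`):
the Kronecker pairing `(x, y) ↦ kroneckerFrame (x ⊗ y) : E'^m × E'^n → E'^{mn}` is `P`-bilinear,
equivariant for `r₁`, `r₂`, `r₁ ⊗ r₂` (accepted `kroneckerFrame_map_toLin'`: in the Kronecker frame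
`x ⊗ y ↦ r₁(σ)x ⊗ r₂(σ)y` is the Kronecker matrix) and its values span, so the accepted
`isAdmissible_of_pairing` applies (as in `isAdmissible_restrictScalars_twist_det`, the case `n = 1`).
[cite: FontaineAsterisque223III, Exp. III Prop. 1.5.2] -/
theorem isAdmissible_restrictScalars_tensor [FiniteDimensional P E'] (r₁ : FramedRep Γ E' m)
    (r₂ : FramedRep Γ E' n) (h₁ : 𝔅.IsAdmissible (FramedRep.restrictScalars P r₁))
    (h₂ : 𝔅.IsAdmissible (FramedRep.restrictScalars P r₂)) :
    𝔅.IsAdmissible (FramedRep.restrictScalars P (r₁.tensor r₂)) := by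
  let φE : (Fin m → E') →ₗ[E'] (Fin n → E') →ₗ[E'] (Fin (m * n) → E') :=
    (TensorProduct.mk E' (Fin m → E') (Fin n → E')).compr₂ (kroneckerFrame E' m n).toLinearMap
  let φ : (Fin m → E') →ₗ[P] (Fin n → E') →ₗ[P] (Fin (m * n) → E') :=
    LinearMap.mk₂ P (fun x y => φE x y) (fun x x' y => by rw [map_add, LinearMap.add_apply])
      (fun c x y => by rw [LinearMap.map_smul_of_tower, LinearMap.smul_apply])
      (fun x y y' => map_add _ _ _) (fun c x y => LinearMap.map_smul_of_tower _ _ _)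
  have hφE : ∀ x y, φE x y = kroneckerFrame E' m n (x ⊗ₜ y) := fun x y => rfl
  have hφ : ∀ (σ : Γ) (x : Fin m → E') (y : Fin n → E'),
      φ (FramedRep.restrictScalars P r₁ σ x) (FramedRep.restrictScalars P r₂ σ y) =
        FramedRep.restrictScalars P (r₁.tensor r₂) σ (φ x y) := by
    intro σ x y
    simp only [φ, LinearMap.mk₂_apply, hφE, FramedRep.restrictScalars_apply_apply]
    rw [FramedRep.tensor_apply, coe_glKronecker, ← kroneckerFrame_map_toLin', TensorProduct.map_tmul,
      Matrix.toLin'_apply, Matrix.toLin'_apply]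
  have hsurj : Submodule.span P (Set.image2 (fun x y => φ x y) Set.univ Set.univ) = ⊤ := by
    refine eq_top_iff.2 ?_
    rintro z -
    obtain ⟨t, rfl⟩ := (kroneckerFrame E' m n).surjective z
    induction t using TensorProduct.induction_on with
    | zero => rw [map_zero]; exact zero_mem _
    | tmul x y => exact Submodule.subset_span ⟨x, Set.mem_univ _, y, Set.mem_univ _, rfl⟩
    | add t t' ht ht' => rw [map_add]; exact add_mem ht ht'
  exact 𝔅.isAdmissible_of_pairing _ _ _ φ hφ hsurj h₁ h₂

end PeriodRingData

/-! ### 3. The Kronecker product of de Rham representations is de Rham -/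

section DeRham

variable {F : Type} [Field F] {ℓ : ℕ} [Fact ℓ.Prime]

-- Mathlib's own global value (nested instance problems on `𝔅.B ⊗[P] M`, see `PAdicHodgeProofs`).
set_option maxSynthPendingDepth 3 in
/-- **The Kronecker product of de Rham representations is de Rham** (Fontaine, Exp. III, Prop. 1.5.2:
`⊗`-stability of `B`-admissibility, for every regular `(ℚ_ℓ, Γ_F)`-ring).  Let `alg` be a
`ℚ_ℓ`-structure on the field `F`, `𝔅` a period-ring datum for `Γ_F` over `ℚ_ℓ` with invariant field `F`
(intended `B_dR(F)`), `ρ : Γ_F →ₜ* GL_m(ℚ̄_ℓ)` and `ρ' : Γ_F →ₜ* GL_n(ℚ̄_ℓ)` both de Rham for `(alg, 𝔅)`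
(accepted `FramedRep.IsDeRhamWith`).  Then `FramedRep.tensor ρ ρ' : Γ_F →ₜ* GL_{mn}(ℚ̄_ℓ)` is de Rham for
`(alg, 𝔅)`.  Proof: finite models `rE₁` of `ρ` over `E₁` and `rE₂` of `ρ'` over `E₂` are moved to the
compositum `E = E₁E₂ ⊆ ℚ̄_ℓ` (accepted `HasQlModel.baseChange_inclusion`), where they are admissible by
model independence (accepted `isAdmissible_of_hasQlModel`); `rE₁ ⊗ rE₂` is a model of `ρ ⊗ ρ'` over `E`
(`HasQlModel.tensor`) with admissible `ℚ_ℓ`-restriction (`isAdmissible_restrictScalars_tensor`).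
[cite: FontaineAsterisque223III, Exp. III Prop. 1.5.2] -/
theorem FramedRep.IsDeRhamWith.tensor (alg : Algebra ℚ_[ℓ] F)
    (𝔅 : PeriodRingData.{0, 0, 0, 0} (absoluteGaloisGroup F) ℚ_[ℓ] F) {m n : ℕ}
    {ρ : FramedRep (absoluteGaloisGroup F) (PadicAlgCl ℓ) m}
    {ρ' : FramedRep (absoluteGaloisGroup F) (PadicAlgCl ℓ) n}
    (hρ : ρ.IsDeRhamWith alg 𝔅) (hρ' : ρ'.IsDeRhamWith alg 𝔅) :
    (ρ.tensor ρ').IsDeRhamWith alg 𝔅 := by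
  letI := alg
  obtain ⟨E₁, hE₁, rE₁, hm₁, -⟩ := id hρ
  obtain ⟨E₂, hE₂, rE₂, hm₂, -⟩ := id hρ'
  haveI := hE₁
  haveI := hE₂
  have h₁ : E₁ ≤ E₁ ⊔ E₂ := le_sup_left
  have h₂ : E₂ ≤ E₁ ⊔ E₂ := le_sup_right
  have hmE₁ := hm₁.baseChange_inclusion h₁
  have hmE₂ := hm₂.baseChange_inclusion h₂
  refine ⟨E₁ ⊔ E₂, inferInstance, _, hmE₁.tensor hmE₂, ?_⟩
  exact 𝔅.isAdmissible_restrictScalars_tensor _ _ (hρ.isAdmissible_of_hasQlModel alg 𝔅 hmE₁)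
    (hρ'.isAdmissible_of_hasQlModel alg 𝔅 hmE₂)

/-- **The Kronecker product of de Rham representations is de Rham, for a `p`-adic Hodge datum**
(accepted `PstWeilDeligneData`, `IsDeRhamFramed`): for every non-archimedean local field `F`, prime `ℓ`
and datum `𝔇 : PstWeilDeligneData F ℓ`, if `ρ : Γ_F →ₜ* GL_m(ℚ̄_ℓ)` and `ρ' : Γ_F →ₜ* GL_n(ℚ̄_ℓ)` are de
Rham for `𝔇` then so is `FramedRep.tensor ρ ρ'` (Fontaine, Exp. III, Prop. 1.5.2;
`FramedRep.IsDeRhamWith.tensor` for `(𝔇.algebra, 𝔇.𝔅)`). [cite: FontaineAsterisque223III, Exp. III Prop. 1.5.2] -/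
theorem PstWeilDeligneData.IsDeRhamFramed.tensor [ValuativeRel F] [TopologicalSpace F]
    [IsNonarchimedeanLocalField F] {𝔇 : PstWeilDeligneData F ℓ} {m n : ℕ}
    {ρ : FramedRep (absoluteGaloisGroup F) (PadicAlgCl ℓ) m}
    {ρ' : FramedRep (absoluteGaloisGroup F) (PadicAlgCl ℓ) n}
    (hρ : 𝔇.IsDeRhamFramed ρ) (hρ' : 𝔇.IsDeRhamFramed ρ') : 𝔇.IsDeRhamFramed (ρ.tensor ρ') :=
  FramedRep.IsDeRhamWith.tensor 𝔇.algebra 𝔇.𝔅 hρ hρ'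

/-- **Clause (F15a) holds for every datum**: `PstWeilDeligneData.TensorDeRham 𝔇` (accepted candidate
clause (F15), part (a), file `PstWeilDeligneTensorCompatible`) is a theorem for EVERY `p`-adic Hodge datum
`𝔇` — not only for Fontaine's. [cite: FontaineAsterisque223III, Exp. III Prop. 1.5.2] -/
theorem PstWeilDeligneData.tensorDeRham [ValuativeRel F] [TopologicalSpace F] [IsNonarchimedeanLocalField F]
    (𝔇 : PstWeilDeligneData F ℓ) : 𝔇.TensorDeRham :=
  fun _ _ _ _ hρ hρ' => hρ.tensor hρ'

/-- Hence **(F15) `TensorCompatible` is equivalent to its Weil–Deligne half (F15b) `TensorWeilDeligne`**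
(`WD(ρ ⊗ ρ') ≅ WD(ρ) ⊗ WD(ρ')`), the part of the clause genuinely pinned only by specification.
[cite: FontaineAsterisque223VIII, §2.3.7] -/
theorem PstWeilDeligneData.tensorCompatible_iff_tensorWeilDeligne [ValuativeRel F] [TopologicalSpace F]
    [IsNonarchimedeanLocalField F] (𝔇 : PstWeilDeligneData F ℓ) :
    𝔇.TensorCompatible ↔ 𝔇.TensorWeilDeligne :=
  ⟨fun h => h.tensorWeilDeligne, fun h => ⟨𝔇.tensorDeRham, h⟩⟩

end DeRham

end Literature.NumberTheory.GaloisRepresentations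

end
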